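import Summits.QuantumFields.BalabanUV.Beta.FP.PerfectFullSandwich
import Summits.QuantumFields.BalabanUV.Beta.D1BFx.FineHessianReflection

/-!
# `BalabanUV.Beta.FP.PerfectFirstMoment` — road «FP» for binder row D1, supplier row «hT1-from-reflection» (owner ruling R-FP-8 (2)), ROOTING-AGNOSTIC
# HALF: the base-point-summed first moments `hT1` of the FULL fine kernel `fineHessA A S Wf` VANISH as soon as every entry is covariant under an affine
# INVERSION — for ANY leg `A`, with only JOINT BLOCK PERIODICITY (resp. COARSE block covariance) asked; and the inversion covariance from relabelling laws

HONEST DEPENDENCY (page 1, mandatory): continuum YM on T⁴ ⇐ BetaPertH ∧ nine spine estimates (0/9 proved); BetaPertH ⇐ (D1) ∧ (D4) ∧ CAP+tail;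
G-an2-4 gates asym, D1 and NE2/3/4.  HONEST FRAMING (cell contract, verbatim): «discharging `BetaPertH` makes Bałaban's UV stability UNCONDITIONAL — a real
constructive-QFT result; it is NOT the continuum limit and NOT the Clay problem.»  THIS MODULE DISCHARGES NOTHING: [folklore] bookkeeping over this lineage's
K-R5/A4-parity lemmas (`D1BFx/MomentTransferParity.sum_firstMoment_baseKer_eq_zero_of_inversion` — (T1-avg) from an affine inversion covariance and columns
summing to zero; `D1BFx/FineHessianReflection.fineHessA_inversion` — the inversion law of `fineHessA` from relabelling laws of leg / stencils / tables) and
leaf-02-g3's `FP/PerfectFullSandwich.isBlockPeriodic_fineHessA_coarse`.  Every covariance / Ward row is a HYPOTHESIS displayed in the signature; no `def`, no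
`Prop` mirror, no cited fact, 0 sorry; 0 wall binders; NOT hrep, NOT D1, NOT BetaPertH, NOT continuum, NOT Clay.

ABSOLUTE RULE (cell charter, verbatim): «No internally-minted statement may enter as a cited fact. Every hypothesis is either kernel-proved in this package or a
verbatim quotation of a PUBLISHED theorem with page reference. The manuscript(s) under audit are NOT citable for their own disputed steps — they are the thing under
adjudication; programme-internal (2001/route/tribunal) claims are never citable.»

WHY.  leaf-02-g3's REP∞ files of record (`PerfectBubbleSandwich` / `PerfectFullSandwich` / `PerfectRepBasePoint`) carry, next to the Ward rows `hrow`, the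
binder `hT1 : ∀ κ′ λ′ μ′, Σ_{r} Σ'_t t_μ′ · baseKer (fineHessA (Π K Π) (Πᵀ S) Wf κ′ λ′) (resSite r) t = 0` (base-point-summed first moments of the full fine
kernel; the owner d1-p3's R-FP-8 (2): «K-R5 is right to carry hT1 … supplier row hT1-from-reflection, OPEN»).  The mechanism is this lineage's: if every entry
of the two-point kernel is covariant under an affine inversion `P (a₁ − s) (a₂ − s′) = P s s′`, the first moments at the base points `b` and `a₂ − b` cancel in
pairs and the base-point SUM over a period vanishes (`sum_firstMoment_baseKer_eq_zero_of_inversion`).  §1 packages that for `fineHessA A S Wf` in EXACTLY the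
consumers' binder shape, asking only joint block periodicity of the entries (§1a) — in particular only COARSE block covariance of `A`, `S`, `Wf` (§1b, the REP∞
situation; leaf-01-g2's in-line version inside `ReducedKernelSandwichLeg.bondSecondMoment_TOfLeg_eq_avgM2_of_inversion` asked FINE covariance) — plus the Ward
rows and a symmetric `Wf`.  §2 discharges the inversion covariance from relabelling laws (`fineHessA_inversion`): a leg law `refK Φ A = A`, a one-bond stencil
law `S κ′ (a κ′ − u) = σ κ′ • refK Φ (S κ′ u)` and the matching two-bond table law with `σ κ′ · σ λ′ = 1`.

ROOTING CAUTION (leaf-02-g3, CLAIMS 2026-08-20T13:55:25Z, from an5's kernel-checked `CornerRootInstance.axProj_not_reflectionCovariant`): for the files of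
record the leg and stencils are the DRESSED letters `axDressK n K = Π K Π`, `coProj n S = Πᵀ S` with the BASE-CORNER-rooted tree-gauge projector `Π`, which is
NOT covariant under block-compatible reflections; so §2's laws are NOT available for those letters from laws of `K`, `S` alone — they are for a CENTRE-rooted
dressing of an odd block (`RootedComb.axProjAt`, `CornerRootInstance.axProjAt_ctr_reflectionCovariant`), i.e. under option (a) of that line / the (R45) literal.
This module therefore states NO instance at `axDressK`/`coProj` (an unfillable antecedent would be vacuous bookkeeping); it supplies the rooting-agnostic half,
to be instantiated by whichever rooting row D1 adopts.  NOT HERE: the reflection laws of the perfect letters (N3(ii): `SymmetryK.refK_KPerf` K-side; S/W rows),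
the re-rooting, the toy check (b).
-/

noncomputable section

namespace Summit.QuantumFields.BalabanUV.Beta.FP.PerfectFirstMoment

open Finset
open scoped BigOperators
open Literature.MathematicalPhysics.QuantumFieldTheory.Balaban1983to89
open Literature.MathematicalPhysics.QuantumFieldTheory.Balaban1983to89.Beta
open ExpKernelCalculus (Site MKer BiLoc shiftK)
open DressedMomentNormalisation (resSite)
open KernelReflection (LegMap refK)
open Summit.QuantumFields.BalabanUV.Beta.TameKernelCalculus (Spr)
open Summit.QuantumFields.BalabanUV.Beta.D1BFx.MomentTransferPeriodic (IsBlockPeriodic baseKer)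
open Summit.QuantumFields.BalabanUV.Beta.D1BFx.MomentTransferPeriodicSum (absMoment₂_periodicMajorant abs_baseKer_le_periodicMajorant)
open Summit.QuantumFields.BalabanUV.Beta.D1BFx.MomentTransferParity (sum_firstMoment_baseKer_eq_zero_of_inversion)
open Summit.QuantumFields.BalabanUV.Beta.D1BFx.ReducedKernelSandwichLeg (fineHessA absMoment₂_baseKer_fineHessA fineHessA_transpose)
open Summit.QuantumFields.BalabanUV.Beta.D1BFx.FineHessianReflection (fineHessA_inversion)
open Summit.QuantumFields.BalabanUV.Beta.FP.PerfectFullSandwich (isBlockPeriodic_fineHessA_coarse)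

variable {F : Type*} [Fintype F] [Nonempty F] {n : ℕ}
  {A : MKer 4 F} {S : Fin 4 → Site 4 → MKer 4 F} {Wf : Fin 4 → Site 4 → Fin 4 → Site 4 → MKer 4 F} {Cs C2 δ : ℝ}

/-! ## §1 `hT1` from an affine inversion covariance of the full fine kernel -/

omit [Nonempty F] in
/-- [folklore] Ward ROWS of every entry of the full fine kernel ⟹ its base-point COLUMNS sum to zero (matrix symmetry for a symmetric `Wf`,
`ReducedKernelSandwichLeg.fineHessA_transpose`), in the `baseKer` shape `MomentTransferParity` consumes. -/
theorem hasSum_baseKer_fineHessA_of_rows (hA : Spr A) (hS : ∀ κ' u, BiLoc (S κ' u) u u Cs δ) (hδ : 0 < δ)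
    (hWsymm : ∀ (κ' : Fin 4) (u : Site 4) (l' : Fin 4) (u' : Site 4), Wf κ' u l' u' = Wf l' u' κ' u)
    (hrow : ∀ (κ' l' : Fin 4) (b : Site 4), HasSum (fineHessA A S Wf κ' l' b) 0) (κ' l' : Fin 4) (b : Site 4) :
    HasSum (baseKer (fineHessA A S Wf κ' l') b) 0 :=
  ((Equiv.hasSum_iff (Equiv.addLeft b)).mpr
    ((hrow l' κ' b).congr_fun fun s => fineHessA_transpose A hA hS hδ hWsymm κ' l' s b)).congr_fun (fun _ => rfl)

/-- [folklore] **§1a `hT1` FROM INVERSION COVARIANCE, BLOCK-PERIODIC FORM** (any leg, any rooting).  A spread leg `A`, bi-localised stencils `S` and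
symmetric bi-tables `Wf` at a common rate, every entry of `fineHessA A S Wf` JOINTLY `n`-BLOCK-PERIODIC (`hP`), Ward rows `hrow`, and an affine inversion
covariance `fineHessA A S Wf κ′λ′ (a₁ κ′ − s) (a₂ λ′ − s′) = fineHessA A S Wf κ′λ′ s s′` ⟹ the base-point-summed first moments vanish — EXACTLY the binder
`hT1` of `PerfectFullSandwich.bondSecondMoment_TPerfOf_eq_avgM2` / `secondMoment_TPerfOf_perfect_eq` and of K-R5's `bondSecondMomentP_tsum_four`. -/
theorem hT1_fineHessA_of_inversion (hn : 0 < n) (hA : Spr A) (hS : ∀ κ' u, BiLoc (S κ' u) u u Cs δ)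
    (hW : ∀ κ' u l' u', BiLoc (Wf κ' u l' u') u u' C2 δ) (hδ : 0 < δ)
    (hWsymm : ∀ (κ' : Fin 4) (u : Site 4) (l' : Fin 4) (u' : Site 4), Wf κ' u l' u' = Wf l' u' κ' u)
    (hP : ∀ κ' l' : Fin 4, IsBlockPeriodic n (fineHessA A S Wf κ' l'))
    (hrow : ∀ (κ' l' : Fin 4) (b : Site 4), HasSum (fineHessA A S Wf κ' l' b) 0)
    {a₁ a₂ : Fin 4 → Site 4}
    (hinv : ∀ (κ' l' : Fin 4) (s s' : Site 4), fineHessA A S Wf κ' l' (a₁ κ' - s) (a₂ l' - s') = fineHessA A S Wf κ' l' s s') :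
    ∀ κ' l' μ' : Fin 4, ∑ r : Fin 4 → Fin n, ∑' t, (t μ' : ℝ) * baseKer (fineHessA A S Wf κ' l') (resSite r) t = 0 :=
  fun κ' l' μ' => sum_firstMoment_baseKer_eq_zero_of_inversion hn (hP κ' l') (hinv κ' l')
    (absMoment₂_periodicMajorant (absMoment₂_baseKer_fineHessA A hA hS hW hδ κ' l'))
    (abs_baseKer_le_periodicMajorant hn (hP κ' l')) (hasSum_baseKer_fineHessA_of_rows hA hS hδ hWsymm hrow κ' l') μ'

/-- [folklore] **§1b `hT1` FROM INVERSION COVARIANCE, COARSE-COVARIANT FORM** (the REP∞ situation: the perfect system at blocking `n` is only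
COARSE-translation covariant).  As §1a with the block periodicity DISCHARGED from coarse block covariance of `A`, `S`, `Wf`
(leaf-02-g3's `PerfectFullSandwich.isBlockPeriodic_fineHessA_coarse`). -/
theorem hT1_fineHessA_of_inversion_coarse (hn : 0 < n) (hA : Spr A) (hAcov : ∀ t : Site 4, shiftK (-((n : ℤ) • t)) A = A)
    (hS : ∀ κ' u, BiLoc (S κ' u) u u Cs δ) (hScov : ∀ (κ' : Fin 4) (u t : Site 4), S κ' (u + (n : ℤ) • t) = shiftK (-((n : ℤ) • t)) (S κ' u))
    (hW : ∀ κ' u l' u', BiLoc (Wf κ' u l' u') u u' C2 δ) (hδ : 0 < δ)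
    (hWcov : ∀ (κ' : Fin 4) (u : Site 4) (l' : Fin 4) (u' t : Site 4),
      Wf κ' (u + (n : ℤ) • t) l' (u' + (n : ℤ) • t) = shiftK (-((n : ℤ) • t)) (Wf κ' u l' u'))
    (hWsymm : ∀ (κ' : Fin 4) (u : Site 4) (l' : Fin 4) (u' : Site 4), Wf κ' u l' u' = Wf l' u' κ' u)
    (hrow : ∀ (κ' l' : Fin 4) (b : Site 4), HasSum (fineHessA A S Wf κ' l' b) 0)
    {a₁ a₂ : Fin 4 → Site 4}
    (hinv : ∀ (κ' l' : Fin 4) (s s' : Site 4), fineHessA A S Wf κ' l' (a₁ κ' - s) (a₂ l' - s') = fineHessA A S Wf κ' l' s s') :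
    ∀ κ' l' μ' : Fin 4, ∑ r : Fin 4 → Fin n, ∑' t, (t μ' : ℝ) * baseKer (fineHessA A S Wf κ' l') (resSite r) t = 0 :=
  hT1_fineHessA_of_inversion hn hA hS hW hδ hWsymm (fun κ' l' => isBlockPeriodic_fineHessA_coarse hAcov hScov hWcov κ' l') hrow hinv

/-! ## §2 The inversion covariance from relabelling laws of the letters -/

/-- [folklore] **§2a `hT1` FROM RELABELLING LAWS, BLOCK-PERIODIC FORM**: the inversion covariance of §1a DISCHARGED (`FineHessianReflection.fineHessA_inversion`)
from a leg law `refK Φ A = A`, the one-bond stencil law `S κ′ (a κ′ − u) = σ κ′ • refK Φ (S κ′ u)` and the two-bond table law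
`Wf κ′ (a κ′ − u) λ′ (a λ′ − u′) = (σ κ′ σ λ′) • refK Φ (Wf κ′ u λ′ u′)` with `σ κ′ · σ λ′ = 1` (inversion through the centres `a κ′ / 2`, with the leg
relabelling `Φ`; on the road: the point inversion of a CENTRE-rooted odd block — see the ROOTING CAUTION in the module docstring). -/
theorem hT1_fineHessA_of_reflLaws (hn : 0 < n) (Φ : LegMap 4 F) (hA : Spr A) (hS : ∀ κ' u, BiLoc (S κ' u) u u Cs δ)
    (hW : ∀ κ' u l' u', BiLoc (Wf κ' u l' u') u u' C2 δ) (hδ : 0 < δ)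
    (hWsymm : ∀ (κ' : Fin 4) (u : Site 4) (l' : Fin 4) (u' : Site 4), Wf κ' u l' u' = Wf l' u' κ' u)
    (hP : ∀ κ' l' : Fin 4, IsBlockPeriodic n (fineHessA A S Wf κ' l'))
    (hrow : ∀ (κ' l' : Fin 4) (b : Site 4), HasSum (fineHessA A S Wf κ' l' b) 0)
    (hAr : refK Φ A = A) (a : Fin 4 → Site 4) (σ : Fin 4 → ℝ) (hσ : ∀ κ' l' : Fin 4, σ κ' * σ l' = 1)
    (hSr : ∀ κ' u, S κ' (a κ' - u) = σ κ' • refK Φ (S κ' u))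
    (hWr : ∀ κ' u l' u', Wf κ' (a κ' - u) l' (a l' - u') = (σ κ' * σ l') • refK Φ (Wf κ' u l' u')) :
    ∀ κ' l' μ' : Fin 4, ∑ r : Fin 4 → Fin n, ∑' t, (t μ' : ℝ) * baseKer (fineHessA A S Wf κ' l') (resSite r) t = 0 :=
  hT1_fineHessA_of_inversion hn hA hS hW hδ hWsymm hP hrow (a₁ := a) (a₂ := a)
    (fun κ' l' s s' => fineHessA_inversion A Φ hA hS hW hδ hAr a σ hσ hSr hWr κ' l' s s')

/-- [folklore] **§2b `hT1` FROM RELABELLING LAWS, COARSE-COVARIANT FORM** (REP∞ currency): §2a with block periodicity from coarse covariance. -/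
theorem hT1_fineHessA_of_reflLaws_coarse (hn : 0 < n) (Φ : LegMap 4 F) (hA : Spr A) (hAcov : ∀ t : Site 4, shiftK (-((n : ℤ) • t)) A = A)
    (hS : ∀ κ' u, BiLoc (S κ' u) u u Cs δ) (hScov : ∀ (κ' : Fin 4) (u t : Site 4), S κ' (u + (n : ℤ) • t) = shiftK (-((n : ℤ) • t)) (S κ' u))
    (hW : ∀ κ' u l' u', BiLoc (Wf κ' u l' u') u u' C2 δ) (hδ : 0 < δ)
    (hWcov : ∀ (κ' : Fin 4) (u : Site 4) (l' : Fin 4) (u' t : Site 4),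
      Wf κ' (u + (n : ℤ) • t) l' (u' + (n : ℤ) • t) = shiftK (-((n : ℤ) • t)) (Wf κ' u l' u'))
    (hWsymm : ∀ (κ' : Fin 4) (u : Site 4) (l' : Fin 4) (u' : Site 4), Wf κ' u l' u' = Wf l' u' κ' u)
    (hrow : ∀ (κ' l' : Fin 4) (b : Site 4), HasSum (fineHessA A S Wf κ' l' b) 0)
    (hAr : refK Φ A = A) (a : Fin 4 → Site 4) (σ : Fin 4 → ℝ) (hσ : ∀ κ' l' : Fin 4, σ κ' * σ l' = 1)
    (hSr : ∀ κ' u, S κ' (a κ' - u) = σ κ' • refK Φ (S κ' u))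
    (hWr : ∀ κ' u l' u', Wf κ' (a κ' - u) l' (a l' - u') = (σ κ' * σ l') • refK Φ (Wf κ' u l' u')) :
    ∀ κ' l' μ' : Fin 4, ∑ r : Fin 4 → Fin n, ∑' t, (t μ' : ℝ) * baseKer (fineHessA A S Wf κ' l') (resSite r) t = 0 :=
  hT1_fineHessA_of_reflLaws hn Φ hA hS hW hδ hWsymm (fun κ' l' => isBlockPeriodic_fineHessA_coarse hAcov hScov hWcov κ' l') hrow hAr a σ hσ hSr hWr

end Summit.QuantumFields.BalabanUV.Beta.FP.PerfectFirstMoment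

end
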